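import Summits.AnomalousDissipation.AnomalousDissipation.Theorems.SolenoidalFractalHomogenisationLagrangianStepVmodFrameDefsJ
import Literature.Analysis.FluidPDE.PassiveVectorTensorDistortedFrameTest
import HarnessLib

/-!
# K1L_D (stmt-AnomalousDissipation-27980), (ℓ3-A) road A, J-CUT plumbing (K): the `G`-SOLENOIDAL CLOSED CLASS of `V2` and its orthogonal projection
(Summits-side definitions file of route `SolenoidalFractalHomogenisation`; review lane; prover ad-k1loc-p3 g11; RULING D28-18 (2), plumbing input (K) of
the twisted assembly `…VmodFrameAssemblyJ` — sketch `HOME/ad-k1loc-p3/BlockBoundGJ-sketch-p3g11.lean`, evidence #43.)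

For a matrix field `Gs : 𝕋³ → Matrix (Fin 3) (Fin 3) ℝ` the `Gs`-solenoidal `L²` classes `{v : ∇·(Gs v) = 0 weakly}` form a CLOSED subspace of
`V2 = L²(𝕋³; ℝ³)`: the intersection of the kernels of the continuous functionals `v ↦ ⟪v, Gsᵀ∇θ⟫_{L²}` over smooth `θ` — the `G`-twin of the flat
`Torus.divFreeL2` (`…PassiveVectorTensorPropagator`).  The carrier is phrased through these `L²` pairings (so the algebra and the closedness need
NO regularity of `Gs`); for `Gs` with continuous entries membership is `Torus.IsWeaklyDivFree (Torus.distort Gs v)` (`mem_solClass_iff`).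
* `VmodDist.solClass Gs : Submodule ℝ V2`, `isClosed_solClass`, `completeSpace_solClass`, `hasOrthogonalProjection_solClass`;
* `memLp_two_distort` (a bounded continuous frame maps `L²` to `L²`), `integral_inner_distort_eq_integral_inner_transpose` (`∫⟪G v, z⟫ = ∫⟪v, Gᵀ z⟫`),
  `mem_solClass_iff`; the range of a distorted propagator lies in the class of its time: `IsDistortedPropagator.apply_mem_solClass`.
Definitions + their API only; NOT a proof of any block, of K1L_D or of AD; rung F-D1.A0.  [cite: Temam1984, Ch. I §1.4 Thm. 1.4]
-/

set_option linter.dupNamespace false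

noncomputable section

namespace Summit.AnomalousDissipation.AnomalousDissipation.Theorems.SolenoidalFractalHomogenisation.LagrangianStep.VmodDist

open Literature.Analysis Literature.Analysis.FluidPDE Literature.Analysis.FunctionSpaces
open MeasureTheory Set Filter UnitAddTorus
open scoped ENNReal NNReal InnerProductSpace
open Summit.AnomalousDissipation.AnomalousDissipation.Theorems.SolenoidalFractalHomogenisation.LagrangianStep.CellClauseMod

/-! ## §1 The class, through `L²` pairings -/

/-- **The `Gs`-solenoidal closed class of `V2`**: the classes `v` with `⟪v, Gsᵀ∇θ⟫_{L²} = 0` for every smooth `θ` whose transposed-gradient field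
`Gsᵀ∇θ` is square integrable (always, for continuous `Gs`; then `v ∈ solClass Gs ↔ Torus.IsWeaklyDivFree (Gs • v)`, `mem_solClass_iff`).
[cite: Temam1984, Ch. I §1.4 Thm. 1.4] -/
def solClass (Gs : UnitAddTorus (Fin 3) → Matrix (Fin 3) (Fin 3) ℝ) : Submodule ℝ V2 where
  carrier := {v | ∀ θ : UnitAddTorus (Fin 3) → ℝ, Torus.IsSmooth θ →
    ∀ h : MemLp (Torus.distort (fun y => (Gs y).transpose) (Torus.gradient θ)) 2 volume, ⟪(v : V2), h.toLp _⟫_ℝ = 0}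
  add_mem' := fun {v w} hv hw θ hθ h => by
    show ⟪v + w, h.toLp _⟫_ℝ = 0
    rw [inner_add_left, hv θ hθ h, hw θ hθ h, add_zero]
  zero_mem' := fun θ hθ h => by
    show ⟪(0 : V2), h.toLp _⟫_ℝ = 0
    exact inner_zero_left _
  smul_mem' := fun c v hv θ hθ h => by
    show ⟪c • v, h.toLp _⟫_ℝ = 0
    rw [real_inner_smul_left, hv θ hθ h, mul_zero]

/-- Membership, unfolded. -/
theorem mem_solClass_iff_inner {Gs : UnitAddTorus (Fin 3) → Matrix (Fin 3) (Fin 3) ℝ} (v : V2) :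
    v ∈ solClass Gs ↔ ∀ θ : UnitAddTorus (Fin 3) → ℝ, Torus.IsSmooth θ →
      ∀ h : MemLp (Torus.distort (fun y => (Gs y).transpose) (Torus.gradient θ)) 2 volume, ⟪v, h.toLp _⟫_ℝ = 0 := Iff.rfl

/-- **The class is closed** (an intersection of kernels of continuous linear functionals). -/
theorem isClosed_solClass (Gs : UnitAddTorus (Fin 3) → Matrix (Fin 3) (Fin 3) ℝ) : IsClosed (solClass Gs : Set V2) := by
  have e : (solClass Gs : Set V2) = ⋂ θ : {θ : UnitAddTorus (Fin 3) → ℝ // Torus.IsSmooth θ},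
      ⋂ h : MemLp (Torus.distort (fun y => (Gs y).transpose) (Torus.gradient θ.1)) 2 volume, {v : V2 | ⟪v, h.toLp _⟫_ℝ = 0} := by
    ext v
    simp only [SetLike.mem_coe, mem_solClass_iff_inner, Set.mem_iInter, Set.mem_setOf_eq]
    exact ⟨fun hv θ h => hv θ.1 θ.2 h, fun hv θ hθ h => hv ⟨θ, hθ⟩ h⟩
  rw [e]
  exact isClosed_iInter fun θ => isClosed_iInter fun h => isClosed_eq (continuous_id.inner continuous_const) continuous_const

/-- The class is complete … -/
theorem completeSpace_solClass (Gs : UnitAddTorus (Fin 3) → Matrix (Fin 3) (Fin 3) ℝ) : CompleteSpace (solClass Gs) :=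
  (isClosed_solClass Gs).completeSpace_coe

/-- … hence admits the orthogonal projection `(solClass Gs).starProjection`. -/
theorem hasOrthogonalProjection_solClass (Gs : UnitAddTorus (Fin 3) → Matrix (Fin 3) (Fin 3) ℝ) : (solClass Gs).HasOrthogonalProjection := by
  haveI := completeSpace_solClass Gs
  exact Submodule.HasOrthogonalProjection.ofCompleteSpace _

/-! ## §2 Membership for frames with continuous entries -/

/-- A frame with continuous (hence bounded) entries maps `L²` fields to `L²` fields. -/
theorem memLp_two_distort {Gs : UnitAddTorus (Fin 3) → Matrix (Fin 3) (Fin 3) ℝ} (hGs : ∀ a c, Continuous fun y => Gs y a c)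
    {f : VF} (hf : MemLp f 2 volume) : MemLp (Torus.distort Gs f) 2 volume := by
  -- measurability
  have hcoord : ∀ a, AEMeasurable (fun y => (WithLp.ofLp (f y)) a) volume := fun a =>
    ((PiLp.continuous_apply 2 (fun _ : Fin 3 => ℝ) a).measurable.comp_aemeasurable hf.1.aemeasurable)
  have hpi : AEMeasurable (fun y => fun c => ∑ a, Gs y c a * (WithLp.ofLp (f y)) a) volume := by
    refine aemeasurable_pi_lambda _ fun c => ?_
    exact Finset.aemeasurable_sum (f := fun a y => Gs y c a * (WithLp.ofLp (f y)) a) Finset.univ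
      fun a _ => ((hGs c a).measurable.aemeasurable).mul (hcoord a)
  have hrepr : Torus.distort Gs f = fun y => WithLp.toLp 2 (fun c => ∑ a, Gs y c a * (WithLp.ofLp (f y)) a) := by
    funext y; ext c; rw [Torus.distort_apply]
  have hmeas : AEStronglyMeasurable (Torus.distort Gs f) volume := by
    rw [hrepr]
    exact ((PiLp.continuous_toLp 2 (fun _ : Fin 3 => ℝ)).measurable.comp_aemeasurable hpi).aestronglyMeasurable
  -- a bound on the entries
  have hc : Continuous fun y => (fun a c => Gs y a c : Fin 3 → Fin 3 → ℝ) := continuous_pi fun a => continuous_pi fun c => hGs a c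
  obtain ⟨C, hC⟩ := isCompact_univ.exists_bound_of_continuousOn (hc.continuousOn (s := univ))
  have hB : ∀ y a c, |Gs y a c| ≤ max C 0 := fun y a c => by
    have h := hC y (mem_univ y)
    have h1 : ‖(fun a c => Gs y a c : Fin 3 → Fin 3 → ℝ) a‖ ≤ ‖(fun a c => Gs y a c : Fin 3 → Fin 3 → ℝ)‖ :=
      norm_le_pi_norm (fun a c => Gs y a c : Fin 3 → Fin 3 → ℝ) a
    have h2 : ‖(fun c => Gs y a c : Fin 3 → ℝ) c‖ ≤ ‖(fun c => Gs y a c : Fin 3 → ℝ)‖ := norm_le_pi_norm (fun c => Gs y a c : Fin 3 → ℝ) c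
    rw [Real.norm_eq_abs] at h2
    exact (h2.trans (h1.trans h)).trans (le_max_left _ _)
  refine MemLp.of_le_mul (c := Real.sqrt (Fintype.card (Fin 3)) * ((Fintype.card (Fin 3) : ℝ) * max C 0)) hf hmeas
    (Filter.Eventually.of_forall fun y => ?_)
  have h := Torus.norm_distort_le_of_le (le_max_right C 0) f y (hB y)
  calc ‖Torus.distort Gs f y‖ ≤ Real.sqrt (Fintype.card (Fin 3)) * ((Fintype.card (Fin 3) : ℝ) * max C 0 * ‖f y‖) := h
    _ = Real.sqrt (Fintype.card (Fin 3)) * ((Fintype.card (Fin 3) : ℝ) * max C 0) * ‖f y‖ := by ring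

/-- Transposition under the `L²` pairing: `∫⟪G v, z⟫ = ∫⟪v, Gᵀ z⟫`. -/
theorem integral_inner_distort_eq_integral_inner_transpose (Gs : UnitAddTorus (Fin 3) → Matrix (Fin 3) (Fin 3) ℝ) (v z : VF) :
    ∫ y, ⟪Torus.distort Gs v y, z y⟫_ℝ = ∫ y, ⟪v y, Torus.distort (fun y => (Gs y).transpose) z y⟫_ℝ := by
  refine integral_congr_ae (Filter.Eventually.of_forall fun y => ?_)
  show ⟪Torus.distort Gs v y, z y⟫_ℝ = ⟪v y, Torus.distort (fun y => (Gs y).transpose) z y⟫_ℝ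
  rw [PiLp.inner_apply, PiLp.inner_apply]
  simp only [Torus.distort_apply, Matrix.transpose_apply, RCLike.inner_apply, conj_trivial, Finset.mul_sum, Finset.sum_mul]
  rw [Finset.sum_comm]
  refine Finset.sum_congr rfl fun a _ => Finset.sum_congr rfl fun c _ => ?_
  ring

/-- The pairing of an `L²` class with a fixed `L²` field is the `L²` inner product with its class. -/
theorem integral_inner_coeFn_eq_inner_toLp {φ : VF} (hφ : MemLp φ 2 volume) (y : V2) :
    ∫ x, ⟪((y : V2) : VF) x, φ x⟫_ℝ = ⟪y, hφ.toLp φ⟫_ℝ := by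
  rw [MeasureTheory.L2.inner_def]
  refine integral_congr_ae ?_
  filter_upwards [hφ.coeFn_toLp] with x hx
  rw [hx]

/-- **Membership for frames with continuous entries**: `v ∈ solClass Gs ↔ ∇·(Gs v) = 0` weakly. -/
theorem mem_solClass_iff {Gs : UnitAddTorus (Fin 3) → Matrix (Fin 3) (Fin 3) ℝ} (hGs : ∀ a c, Continuous fun y => Gs y a c) (v : V2) :
    v ∈ solClass Gs ↔ Torus.IsWeaklyDivFree (Torus.distort Gs ((v : V2) : VF)) := by
  have hGsT : ∀ a c, Continuous fun y => (Gs y).transpose a c := fun a c => by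
    simp only [Matrix.transpose_apply]; exact hGs c a
  have hmem : ∀ θ : UnitAddTorus (Fin 3) → ℝ, Torus.IsSmooth θ →
      MemLp (Torus.distort (fun y => (Gs y).transpose) (Torus.gradient θ)) 2 volume := fun θ hθ =>
    memLp_two_distort hGsT ((Torus.IsSmooth.gradient hθ).memLp 2)
  constructor
  · intro hv θ hθ
    rw [integral_inner_distort_eq_integral_inner_transpose, integral_inner_coeFn_eq_inner_toLp (hmem θ hθ)]
    exact hv θ hθ (hmem θ hθ)
  · intro hv θ hθ h
    rw [← integral_inner_coeFn_eq_inner_toLp h, ← integral_inner_distort_eq_integral_inner_transpose]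
    exact hv θ hθ

/-- **The range of a distorted propagator at time `t` lies in the `G(t)`-solenoidal class** (frame with continuous entries). -/
theorem _root_.Summit.AnomalousDissipation.AnomalousDissipation.Theorems.SolenoidalFractalHomogenisation.LagrangianStep.CellClauseMod.IsDistortedPropagator.apply_mem_solClass
    {Tw : ℝ} {𝔸 : Torus.Visc4 (Fin 3)} {b : ℝ → VF} {G : ℝ → UnitAddTorus (Fin 3) → Matrix (Fin 3) (Fin 3) ℝ} {U : ℝ → ℝ → (V2 →L[ℝ] V2)}
    (hU : IsDistortedPropagator Tw 𝔸 b G U) {t : ℝ} (hGt : ∀ a c, Continuous fun y => G t y a c) (s : ℝ) (y : V2) :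
    U s t y ∈ solClass (G t) :=
  (mem_solClass_iff hGt _).2 (hU.divFree s t y)

end Summit.AnomalousDissipation.AnomalousDissipation.Theorems.SolenoidalFractalHomogenisation.LagrangianStep.VmodDist

end
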